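import Summits.Parity.GeneralizedHardyLittlewood.Theses.LiouvilleShiftedTables
import Summits.Parity.GeneralizedHardyLittlewood.Theses.DicksonFibration

/-!
# Line-lead eligibility record for crux `PairsToGHL` (stmt-Parity-9389)

Kernel-checked logic behind `PICKED.md` / the three `line-*.dead.md` notes of the LINE lead
(prover-line-stmt-Parity-9389-0, 2026-08-16). Nothing here is a Theorems landing; it is evidence.

* `pairsToGHL_iff`            : the crux is literally `PairsHL → GeneralizedHardyLittlewood`.
* `pairsToGHL_and_pairsHL_iff`: joined with the routes' own target `PairsHL`, the crux IS the
  summit conjunct (so any composition `stub₁ → … → PairsToGHL` has a stub at least as strong as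
  `PairsHL → GeneralizedHardyLittlewood`).
* `dimOne_of_ghl`, `pairsToGHL_of_dimOne`, `pairsToGHL_iff_pairs_imp_dimOne`: modulo the fibration
  item `DicksonFibration.Assembly` (stmt-Parity-0822) the crux is exactly `PairsHL → DimOne`
  (stmt-Parity-0819) — the only honest "skeleton" has the two EXISTING items 0819/0822 as its stubs.
-/

namespace Summit.Parity.GeneralizedHardyLittlewood.Cruxes.PairsToGHL.LeadEligibility

open Summit.Parity.GeneralizedHardyLittlewood.Theses

/-- The crux unfolds to `PairsHL → GHL` (the route's own `PairsHL`, inlined verbatim). -/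
theorem pairsToGHL_iff :
    LiouvilleShiftedTables.PairsToGHL ↔
      (LiouvilleShiftedTables.PairsHL → _root_.GeneralizedHardyLittlewood) :=
  Iff.rfl

/-- `GHL → DimOne`: specialise Green–Tao Conj. 1.2 to `d = 1`. -/
theorem dimOne_of_ghl (hG : _root_.GeneralizedHardyLittlewood) : DicksonFibration.DimOne := by
  intro t L ht ε hε
  obtain ⟨N₀, hN₀⟩ := hG 1 t L le_rfl ht ε hε
  refine ⟨N₀, fun N hN Ψ hΨ hL K hK hKN => ?_⟩
  simpa only [pow_one] using hN₀ N hN Ψ hΨ hL K hK hKN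

/-- The `dimone-subsumption` composition: `DimOne ∧ (DimOne → GHL) ⊢ PairsToGHL`, with the crux
hypothesis `PairsHL` unused (its two "stubs" are the existing items stmt-Parity-0819 / 0822). -/
theorem pairsToGHL_of_dimOne (hD : DicksonFibration.DimOne) (hF : DicksonFibration.Assembly) :
    LiouvilleShiftedTables.PairsToGHL :=
  fun _ => hF hD

/-- Modulo the fibration item 0822 the crux is EXACTLY `PairsHL → DimOne`. -/
theorem pairsToGHL_iff_pairs_imp_dimOne (hF : DicksonFibration.Assembly) :
    LiouvilleShiftedTables.PairsToGHL ↔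
      (LiouvilleShiftedTables.PairsHL → DicksonFibration.DimOne) :=
  ⟨fun h hP => dimOne_of_ghl (h hP), fun h hP => hF (h hP)⟩

/-- Truth table: `GHL → PairsToGHL`, `¬PairsHL → PairsToGHL`, and under `PairsHL` the crux is
the summit conjunct itself. -/
theorem pairsToGHL_truthTable :
    (_root_.GeneralizedHardyLittlewood → LiouvilleShiftedTables.PairsToGHL) ∧
    (¬ LiouvilleShiftedTables.PairsHL → LiouvilleShiftedTables.PairsToGHL) ∧
    (LiouvilleShiftedTables.PairsHL →
      (LiouvilleShiftedTables.PairsToGHL ↔ _root_.GeneralizedHardyLittlewood)) :=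
  ⟨fun h _ => h, fun h hP => absurd hP h, fun hP => ⟨fun h => h hP, fun h _ => h⟩⟩

/-- What an unconditional refutation would be: a proof of `PairsHL` AND a disproof of GHL. -/
theorem not_pairsToGHL_iff :
    ¬ LiouvilleShiftedTables.PairsToGHL ↔
      (LiouvilleShiftedTables.PairsHL ∧ ¬ _root_.GeneralizedHardyLittlewood) := by
  rw [pairsToGHL_iff, Classical.not_imp]

/-- The four route copies of the crux are one statement (shared ledger item). -/
theorem shared_decls :
    (LiouvilleShiftedTables.PairsToGHL ↔
      (LiouvilleShiftedTables.PairsHL → _root_.GeneralizedHardyLittlewood)) ∧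
    (DicksonFibration.Assembly ↔ (DicksonFibration.DimOne → _root_.GeneralizedHardyLittlewood)) :=
  ⟨Iff.rfl, Iff.rfl⟩

end Summit.Parity.GeneralizedHardyLittlewood.Cruxes.PairsToGHL.LeadEligibility
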